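import Summits.ResolutionOfSingularities.ResolutionOfSingularities.Theorems.DeepCrossCutClasses
import HarnessLib

/-!
# DeepCrossCutClasses2 — decomp-res node «DeepCrossCut» (lens-2 g22 rev8), file 2/2 of `DeepCrossCutClasses`

Content VERBATIM from the decomp-res lens-2 g22 node `HOME/decomp-res-lens-2/g22/DeepCrossCut.lean` rev8 (pin
8b8ca19c, 5 810 l; HOME = run/shared/lean/pub/decomp-res); CRITIC-LEDGER row 180 CLEARED ((X**) `DeepCrossExit`
DECIDED-MOD-PORT(M+) +1, MAP +1 (b′) fan game; rev8 = rev7 + the ONE residue-characteristic-2 GUARD of row 175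
(d″)(α′)); landing orders row 180 / critic INBOX :875: l. 143–4449 of the lens file are the earlier lens-2 nodes
RESTATED VERBATIM-IN-BODY (landed as `PurityCut*`, `SplitCut*`, `CylinderCut*`, `SpreadCut*`, `CrossCut*`,
`MaxContactCut{PurityCut,SplitCut,CylinderCut,SpreadCut,CrossCut}`) and are NOT restated here — the landed modules
are imported and opened instead; §Y.0 (ring level) + the inhabitant kernels landed earlier from g21 as
`DeepCrossCutKernels`, `…2`, `…3` (+ `DeepCrossCutKernelsCross`, the four cross-weight comparisons); THIS chain is
the NEW scheme layer §Y.2 + §Y.4–§Y.7 only, namespace `…Theses.DeepCrossCut` ↦ `…Theorems.DeepCrossCut`, split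
cone-free (`DeepCrossCutClasses*`, `DeepCrossCutCells*`) / Theses-cone (`MaxContactCutDeepCrossCut*`), files ≤ 400
lines, `--supports stmt-ResolutionOfSingularities-29273` (`MaxContactCut.RungOne`).  Column bookkeeping (row 180):
ONE aside SWITCH on the lens-2 column to `Deep.DeepSpecialRung` (home `DeepCrossCutCells*`), SUPERSEDING rev 50's
aside 33866 `MaxContactCut.LeafSpecialRung` via the exact re-locations.

§Y.2 (rev8) point / curve level — the node letters (N) (`IsNodeAt` / pivot), the deep-cross letters (X**)
(`IsDeepCrossAt`, steep pair), the uniform classes incl. the rev8 GUARDED `IsUniformDeepCross` (residue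
characteristic 2 — critic row 175 (d″)(α′); the 𝔽₃ non-principal datum of the unguarded class is residual by
complement) with its two `ringChar_*` kernels, the ENGINES `def DeepCrossExit : Prop` / node engine (paper engines:
hypotheses, untagged `def … : Prop`, DECIDED-MOD-PORT(M+) by row 180 — the kernel half of the (X**) decision is the
fan game `Theorems/DeepCrossCutFanGame*`), `IsDeepCrossPt` / `IsNodePt` and the decided classes (continued `…2`
where the 400-line cap cuts).  The §Y.0 ring kernels and the inhabitant kernels are ALREADY in the tree
(`DeepCrossCutKernels`, `…2`, `…3`, `DeepCrossCutKernelsCross`, same namespace) and are not restated.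

Part 2/2 carries: `IsDeepCrossAt`, `isCrossAt_of_isDeepCrossAt_self`, `IsSteepPairAt`, `IsUniformDeepCross`,
`DeepCrossExit`, `DeepCrossExit57`, `deepCrossExit57_of_deepCrossExit`, `IsDeepCrossPt`, `eq_two_of_isDeepCrossPt`,
`idealOrder_eq_of_isDeepCrossPt`, `isTopComponent_of_isUniformDeepCross`, `ringChar_eq_two_of_isUniformDeepCross`,
`ringChar_residueField_eq_two_of_two_eq_zero`, `isComponentExitPt_of_isDeepCrossPt`.

(Sources: Hironaka1964 Ch. III; CossartJannsenSaito2020 Ch. 2, Ch. 8–9; CossartPiltant2008 Prop. 4.2;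
CossartPiltant2019 Rem. 3.2; BierstoneGrigorievMilmanWlodarczyk2011 §3.1; Moh1987; Hauser2010Kangaroo; Giraud1975;
Narasimhan1983; DershowitzManna1979.)
-/

open CategoryTheory AlgebraicGeometry TopologicalSpace IsLocalRing
open Literature.AlgebraicGeometry.Resolution
open Summit.ResolutionOfSingularities.ResolutionOfSingularities.Theorems
open Summit.ResolutionOfSingularities.ResolutionOfSingularities.Theorems.WeakOrderReduction
open Summit.ResolutionOfSingularities.ResolutionOfSingularities.Theorems.DeltaFaceCutClasses
open Summit.ResolutionOfSingularities.ResolutionOfSingularities.Theorems.RelativeDeltaCut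
open Summit.ResolutionOfSingularities.ResolutionOfSingularities.Theorems.CurveLeafExit
open Summit.ResolutionOfSingularities.ResolutionOfSingularities.Theorems.PinchCut
open Summit.ResolutionOfSingularities.ResolutionOfSingularities.Theorems.JetCut
open Summit.ResolutionOfSingularities.ResolutionOfSingularities.Theorems.PurityCut
open Summit.ResolutionOfSingularities.ResolutionOfSingularities.Theorems.SplitCut
open Summit.ResolutionOfSingularities.ResolutionOfSingularities.Theorems.CylinderCut
open Summit.ResolutionOfSingularities.ResolutionOfSingularities.Theorems.SpreadCut
open Summit.ResolutionOfSingularities.ResolutionOfSingularities.Theorems.CrossCut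
open MvPolynomial

namespace Summit.ResolutionOfSingularities.ResolutionOfSingularities.Theorems.DeepCrossCut

/-- **DEEP-CROSS-SHAPED at `y`, the tangle point of the branches `η₁` (steep) and `η₂` (flat, deep)** [g21]
(`IsDeepCrossAt I q d η₁ η₂ y`):
g20's `IsCrossAt` with the NEWTON-TYPED deep letter `DeepCrossNewtShape (stalkIdeal I y) c q d` (inert depth `d ≥ m
= 2q+1` on the flat
branch; RE-TYPED in rev7 — critic row 168 (d′)(α) —: members in the Newton member ideal `deepNewt`; rev ≤ 6 used the
triply-weighted
`DeepCrossShape`, which at `d = m` is g20's `CrossShape`, and the class SHRANK: `isCrossAt_of_isDeepCrossAt_self`, Probe P25).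
DEFINITION (NEW class predicate). (Sources: Hironaka1967; CossartJannsenSaito2020 Ch. 8; CossartPiltant2019 Def. 3.5.) -/
def IsDeepCrossAt {Y : Scheme.{0}} (I : Y.IdealSheafData) (q d : ℕ) (η₁ η₂ y : Y) : Prop :=
  ∃ (h₁ : η₁ ⤳ y) (h₂ : η₂ ⤳ y) (c : Fin 4 → Y.presheaf.stalk y),
    Ideal.span {c 0, c 1, c 2} = curvePrime h₁ ∧ Ideal.span {c 0, c 1, c 3} = curvePrime h₂ ∧
      Ideal.span (Set.range c) = maximalIdeal (Y.presheaf.stalk y) ∧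
      (maximalIdeal (Y.presheaf.stalk y)).spanFinrank = 4 ∧
      DeepCrossNewtShape (stalkIdeal I y) c q d

/-- At depth `d = m` a deep-cross-shaped point is IN PARTICULAR g20's cross-shaped point (consistency; one direction
— the Newton-typed
class at `d = m` is a subclass of g20's, Probe P25).  KERNEL (PROVED). [folklore] -/
theorem isCrossAt_of_isDeepCrossAt_self {Y : Scheme.{0}} {I : Y.IdealSheafData} {q : ℕ} {η₁ η₂ y : Y}
    (h : IsDeepCrossAt I q (2 * q + 1) η₁ η₂ y) : IsCrossAt I q η₁ η₂ y := by
  obtain ⟨h₁, h₂, c, hc₁, hc₂, hm, hr, hS⟩ := h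
  exact ⟨h₁, h₂, c, hc₁, hc₂, hm, hr, crossShape_of_deepCrossNewtShape_self hS⟩

/-- **STEEP-PAIR-SHAPED at `y` along the steep branch `η₁`** [g21] (`IsSteepPairAt I m d η₁ y`): a minimal system `c
= (z, x, y′, t)` with
`(z, x, y′)` generating `curvePrime (η₁ ⤳ y)` (`t` inert) and `I_y` of STEEP-PAIR SHAPE `z² + ε₁x^m + ε₃y′^d + …`
(the flat branch's pinch
coefficient has become a unit away from the tangle).  DEFINITION (NEW class predicate). (Sources: Hironaka1967;
CossartJannsenSaito2020 Ch. 8.) -/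
def IsSteepPairAt {Y : Scheme.{0}} (I : Y.IdealSheafData) (m d : ℕ) (η₁ y : Y) : Prop :=
  ∃ (h₁ : η₁ ⤳ y) (c : Fin 4 → Y.presheaf.stalk y),
    Ideal.span {c 0, c 1, c 2} = curvePrime h₁ ∧
      Ideal.span (Set.range c) = maximalIdeal (Y.presheaf.stalk y) ∧
      (maximalIdeal (Y.presheaf.stalk y)).spanFinrank = 4 ∧
      SteepPairShape (stalkIdeal I y) c m d

/-- **UNIFORM DEEP CROSS** [g21] (`IsUniformDeepCross I n q d η₁ η₂`) — THE UNIT OF ENGINE (X**): marking `n = 2`,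
`q ≥ 1`, `m = 2q+1 ≤ d`,
`d` ODD (even inert depth makes the pinch coefficient a square: `τ = 2` or re-preparation, g20 §1); two DISTINCT
curve points (steep
`η₁`, flat `η₂`) whose closures MEET; `T = C₁ ∪ C₂` lies in the order-`n` locus and is OPEN in it; and at every
CLOSED point the letter
of its position: DEEP-CROSS letter at `C₁ ∩ C₂`, STEEP-PAIR letter `(m, d)` along `C₁ ∖ C₂`, g20's FLANK letter along `C₂ ∖ C₁`
(depth-free: `μ̄` a uniformiser).  EVERY FLAT INERT DEPTH `d ≥ m` AT ONCE (g20: `d = m`).  rev8 (g22; critic row 175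
(d″)(α′)): THE
RESIDUE-CHARACTERISTIC-2 GUARD ALONG `T` — `∀ x, (η₁ ⤳ x ∨ η₂ ⤳ x) → ringChar κ(x) = 2` (tree style `ringChar
(ResidueField (Y.presheaf.stalk x))`;
kernels `ringChar_eq_two_of_isUniformDeepCross`, `ringChar_residueField_eq_two_of_two_eq_zero`): the paper decision
§Y.1 (X**) (LEMMA Y.C,
(T1)–(T5)) is a parity calculus in residue characteristic `2`, and the unguarded class is INHABITED in residue
characteristic `3` (row 175:
`Y = 𝔸⁴_{𝔽₃}`, `I = (z² + u₁⁵ + v²u₂⁷, v²u₂⁸)`, non-principal — in characteristic `≠ 2` no principal ideal has the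
flank letter), where
S3′ diverges at once; such data now sit, honestly, in the located residual `IsDeepSpecialPt` (by complement; the re-location
`Deep.crossSpecialRung_iff_deepSpecialRung` stays exact).  The local rings of `Y` may have any characteristic (no
Frobenius of `𝒪_Y` is
used).  DEFINITION (NEW class predicate). -/
def IsUniformDeepCross {Y : Scheme.{0}} (I : Y.IdealSheafData) (n q d : ℕ) (η₁ η₂ : Y) : Prop :=
  n = 2 ∧ 1 ≤ q ∧ 2 * q + 1 ≤ d ∧ Odd d ∧ η₁ ≠ η₂ ∧ IsCurvePt η₁ ∧ IsCurvePt η₂ ∧ (∃ x : Y, η₁ ⤳ x ∧ η₂ ⤳ x) ∧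
    (∀ x : Y, (η₁ ⤳ x ∨ η₂ ⤳ x) → idealOrder I x = ((n : ℕ) : ℕ∞)) ∧
    (∀ x : Y, (η₁ ⤳ x ∨ η₂ ⤳ x) → ringChar (ResidueField (Y.presheaf.stalk x)) = 2) ∧
    (∃ U : Y.Opens, (∀ x : Y, (η₁ ⤳ x ∨ η₂ ⤳ x) → x ∈ U) ∧
      ∀ x : Y, x ∈ U → idealOrder I x = ((n : ℕ) : ℕ∞) → (η₁ ⤳ x ∨ η₂ ⤳ x)) ∧
    ∀ y : Y, IsClosed ({y} : Set Y) →
      (η₁ ⤳ y → η₂ ⤳ y → IsDeepCrossAt I q d η₁ η₂ y) ∧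
      (η₁ ⤳ y → ¬ η₂ ⤳ y → IsSteepPairAt I (2 * q + 1) d η₁ y) ∧
      (η₂ ⤳ y → ¬ η₁ ⤳ y → IsFlankAt I q η₂ y)

/-- **ENGINE (X**) `DeepCrossExit`** [g21; DECIDED (paper) · KERNEL PORT OPEN — proof device = THE GREEDY INTRINSIC
STRATEGY S3′ of the module
docstring §Y.1 (X**) (repeat: blow up a 2-dimensional component of the order-`2` locus over `T` if there is one;
else a 1-dimensional
component of the `τ = 1` locus over `T` of maximal generic order, ties by maximal `|δ_D| + |δ_{D′}|`; else, at an
isolated `τ = 1` point, a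
1-dimensional component of the order-`2` locus through it over `T` of maximal generic order (PEEL); else stop —
every centre intrinsic,
regular, weakly admissible).  ON THE BED (`z² + x^m + t²y^d`, every odd `3 ≤ m ≤ d`, characteristic `2`) S3′
TERMINATES AND EXITS: LEMMA Y.C
(the run is a parity game on unimodular fans), (T1) centres straddle, (T2) PEEL LEMMA (nodal phase finite), (T4)
TERMINATION THEOREM (the
multiset of the weights `max(|δ_D|, |δ_{D′}|)` of the `τ = 1` lines strictly decreases at every line blow-up) —
paper proofs §Y.1 (X**);
the `620` pairs `m ≤ 41, d ≤ m+60` are also played out by `explore/combi.py` (`ℓ ≤ 367`), and the run on INSEP-vv7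
(`m = 5`, `d = 7`: 9
blow-ups, 10 final charts, kernels `insepVV7_chart0 … insepVV7_chart9`) is CERTIFIED chart by chart
(`explore/CERT-insepvv7.txt`); EVERY
MEMBER of the class rides along the bed's package by the TAIL LEMMA (T5) — tails `g ≠ 0` and units unconditionally
(strict Newton
domination over `T`; cross-checked by 2705 Gröbner runs with tails, §Y.1 EVIDENCE (e)), the other members of `I` by
convexity of the
letter's Newton member ideal `deepNewt` ((T5) STEP 3; member bound RE-TYPED in rev7).  NOT proved IN KERNEL: nothing in
the tree proves this Prop, it stays a hypothesis of the kernels · `n = 2` · residue characteristic `2` along `T` is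
a clause of the class (rev8 guard) —
(T4) and the bed runs ARE in kernel since g22: `Theorems.DeepCrossCutFanGame` (HOME `g22/FanGame.lean`)]: on a
regular scheme, a uniform deep
cross has an exit package with centres over `T = C₁ ∪ C₂`.  STATEMENT (engine). (Sources: Hironaka1967;
CossartJannsenSaito2020 Ch. 2, Ch. 8; CossartPiltant2008 Prop. 4.2; CossartPiltant2019 Def. 3.5;
BierstoneGrigorievMilmanWlodarczyk2011 §3; StacksProject Tag 0805.) -/
def DeepCrossExit : Prop :=
  ∀ (Y : Scheme.{0}), Scheme.IsRegular Y → ∀ (I : Y.IdealSheafData) (n q d : ℕ) (η₁ η₂ : Y),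
    IsUniformDeepCross I n q d η₁ η₂ → PackageExitsOver I n {x : Y | η₁ ⤳ x ∨ η₂ ⤳ x}

/-- **THE CERTIFIED INSTANCE `DeepCrossExit57`** [g21; DECIDED CONCRETELY for the named inhabitant's letters `q =
2`, `d = 7` — the
INSEP-vv7 package of §Y.1 (X**): `(C₁; Σ₁; Λ; Λ′; Σ_Λ; Φ₃; C₂′; Σ′₁; Φ₆)`, nine intrinsic centres, ten final charts with
`F = μ_σ²(Z² + F_σ)` (kernels `insepVV7_chartσ`) and no `τ = 1` point over `T` in any of them (certificate); the
same nine steps decide every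
uniform deep cross with `(q, d) = (2, 7)` (members with tails, and any `I` of the class, by the TAIL LEMMA (T5)) ⇒
tagged DECIDED (paper:
measure AND certificate AND (T5)) · KERNEL PORT OPEN]: the engine restricted to `(q, d) = (2, 7)`.  STATEMENT
(engine instance). -/
def DeepCrossExit57 : Prop :=
  ∀ (Y : Scheme.{0}), Scheme.IsRegular Y → ∀ (I : Y.IdealSheafData) (n : ℕ) (η₁ η₂ : Y),
    IsUniformDeepCross I n 2 7 η₁ η₂ → PackageExitsOver I n {x : Y | η₁ ⤳ x ∨ η₂ ⤳ x}

/-- The engine contains its certified instance by letter.  KERNEL (PROVED). [folklore] -/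
theorem deepCrossExit57_of_deepCrossExit (h : DeepCrossExit) : DeepCrossExit57 :=
  fun Y hY I n η₁ η₂ hU => h Y hY I n 2 7 η₁ η₂ hU

/-- **DEEP-CROSS point** [g21] (NEW CLASS, leaf (X**)): `y` lies on (or is a generic point of a branch of) a uniform
deep cross of some
depth `d ≥ m`.  Inhabitants: the tangle of INSEP-vv7 = `z² + u₁⁵ + v²u₂⁷ /𝔽₂` (`deepCrossNewtShape_insepVV7`;
NODE-g21 §3) and, for every odd
`d ≥ m ≥ 3`, the bed binomial `z² + u₁^m + v²u₂^d`.  DEFINITION (NEW class). -/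
def IsDeepCrossPt {Y : Scheme.{0}} (I : Y.IdealSheafData) (n : ℕ) (y : Y) : Prop :=
  ∃ (q d : ℕ) (η₁ η₂ : Y), (η₁ ⤳ y ∨ η₂ ⤳ y) ∧ IsUniformDeepCross I n q d η₁ η₂

/-- The deep-cross class lives at marking `2` only.  KERNEL (PROVED; letter bookkeeping). [folklore] -/
theorem eq_two_of_isDeepCrossPt {Y : Scheme.{0}} {I : Y.IdealSheafData} {n : ℕ} {y : Y} (h : IsDeepCrossPt I n y) : n = 2 := by
  obtain ⟨_, _, _, _, _, hn, _⟩ := h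
  exact hn

/-- A deep-cross point is a top point.  KERNEL (PROVED). [folklore] -/
theorem idealOrder_eq_of_isDeepCrossPt {Y : Scheme.{0}} {I : Y.IdealSheafData} {n : ℕ} {y : Y} (h : IsDeepCrossPt I n y) :
    idealOrder I y = ((n : ℕ) : ℕ∞) := by
  obtain ⟨_, _, _, _, hy, _, _, _, _, _, _, _, _, hT, _, _⟩ := h
  exact hT _ hy

/-- **A UNIFORM DEEP CROSS IS A TOP COMPONENT** [g21; KERNEL (PROVED)]. [folklore] -/
theorem isTopComponent_of_isUniformDeepCross {Y : Scheme.{0}} {I : Y.IdealSheafData} {n q d : ℕ} {η₁ η₂ : Y}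
    (h : IsUniformDeepCross I n q d η₁ η₂) : IsTopComponent I n {x : Y | η₁ ⤳ x ∨ η₂ ⤳ x} := by
  obtain ⟨_, _, _, _, _, _, _, hmeet, hT, _, hU, _⟩ := h
  exact isTopComponent_of_branches hmeet hT hU

/-- **THE GUARD BY NAME** [g22 rev8; KERNEL (PROVED; letter bookkeeping)]: along `T` a uniform deep cross has
residue characteristic `2`. [folklore] -/
theorem ringChar_eq_two_of_isUniformDeepCross {Y : Scheme.{0}} {I : Y.IdealSheafData} {n q d : ℕ} {η₁ η₂ : Y}
    (h : IsUniformDeepCross I n q d η₁ η₂) {x : Y} (hx : η₁ ⤳ x ∨ η₂ ⤳ x) :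
    ringChar (ResidueField (Y.presheaf.stalk x)) = 2 := by
  obtain ⟨_, _, _, _, _, _, _, _, _, hχ, _⟩ := h
  exact hχ x hx

/-- **THE GUARD ON `𝔽₂`-DATA** [g22 rev8; KERNEL (PROVED)]: where `2 = 0` in the local ring (every point of an
`𝔽₂`-scheme — e.g. INSEP-vv7's
ambient `𝔸⁴_{𝔽₂}` and every blow-up of it), the residue field has characteristic `2`; so the guard holds for the
lineage's named inhabitants
(Probe C24). [folklore] -/
theorem ringChar_residueField_eq_two_of_two_eq_zero {Y : Scheme.{0}} (x : Y) (h2 : (2 : Y.presheaf.stalk x) = 0) :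
    ringChar (ResidueField (Y.presheaf.stalk x)) = 2 := by
  have h := congrArg (residue (Y.presheaf.stalk x)) h2
  rw [map_ofNat, map_zero] at h
  exact CharP.ringChar_of_prime_eq_zero Nat.prime_two (by exact_mod_cast h)

/-- **ENGINE (X**) AT WORK, pointwise** [g21; KERNEL (PROVED)]: under `DeepCrossExit`, every deep-cross point of a
regular scheme is a
component-exit point of g20's component port. [folklore] -/
theorem isComponentExitPt_of_isDeepCrossPt {Y : Scheme.{0}} {I : Y.IdealSheafData} {n : ℕ} {y : Y}
    (hDX : DeepCrossExit) (hY : Scheme.IsRegular Y) (h : IsDeepCrossPt I n y) : IsComponentExitPt I n y := by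
  obtain ⟨q, d, η₁, η₂, hy, hU⟩ := h
  exact ⟨{x : Y | η₁ ⤳ x ∨ η₂ ⤳ x}, hy, isTopComponent_of_isUniformDeepCross hU, hDX Y hY I n q d η₁ η₂ hU⟩

end Summit.ResolutionOfSingularities.ResolutionOfSingularities.Theorems.DeepCrossCut
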